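import Literature.NumberTheory.Sieve.FriedlanderIwaniecPrimesJacobiTwistedForms
import HarnessLib

/-!
# Friedlander–Iwaniec, *The polynomial `X² + Y⁴` captures its primes*, §12: the parameter
# bookkeeping of Proposition 12.1 (`H = (RS/D)^{1/3}`, logarithms)

[FI, §12, p. 51 of arXiv:math/9811185 = Ann. of Math. (2) 148 (1998), 945–1040]: "Summing over `m`
and `c` we conclude that `V(D) ≪ {D + (DHRS)^{1/2}(log 2RS)⁴ + H⁻¹RS log 2RS + [D⁻¹(RS)^{3/2} + RS^{3/4}
 + SR^{3/4}](RS)^ε} ∑∑τ(r)|α_{rs}|²`.  We choose `H = (D⁻¹RS)^{1/3}` getting (12.4)."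

This file PROVES the elementary identities and inequalities behind that choice
(`rpow_third_bookkeeping`: `H ≥ 1`, `RS/H = (DHRS)^{1/2} = D^{1/3}(RS)^{2/3}`, `H²√(RS) ≤ (RS)^{3/2}/D`,
`log H ≤ log 2RS` for `D < RS`) and the logarithm bookkeeping (`log_bookkeeping`: every logarithm
met in §12 is `≤ 8 log 2RS`).  No definitions, no named facts
(HOME/parity-ideate-lit/FI98-Prop121-MAP.md, step D-h of the g26 addendum).

## References

* J. Friedlander, H. Iwaniec, *The polynomial `X² + Y⁴` captures its primes*, Ann. of Math. (2) 148
  (1998), 945–1040, §12, (12.4), (12.17). [FriedlanderIwaniecAnnals1998]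
-/

noncomputable section

open Real

namespace Literature.NumberTheory.Sieve.FriedlanderIwaniecPrimes

/-- **Logarithm bookkeeping for (12.4)**: for `R, S ≥ 1` and `𝓛 = log 2RS`: `log 2 ≤ 𝓛`, `1 ≤ 2𝓛`,
`log 2R ≤ 𝓛`, `0 ≤ log RS ≤ 𝓛`, `0 ≤ log S ≤ 𝓛`, and for `D, c ≥ 1`:
`1 + log max(1, 24RS/(cD)) ≤ 8𝓛`. [cite: FriedlanderIwaniecAnnals1998, §12, (12.4)] -/
theorem log_bookkeeping {R S : ℝ} (hR : 1 ≤ R) (hS : 1 ≤ S) :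
    Real.log 2 ≤ Real.log (2 * R * S) ∧ 1 ≤ 2 * Real.log (2 * R * S) ∧
      Real.log (2 * R) ≤ Real.log (2 * R * S) ∧ 0 ≤ Real.log (R * S) ∧
      Real.log (R * S) ≤ Real.log (2 * R * S) ∧ 0 ≤ Real.log S ∧ Real.log S ≤ Real.log (2 * R * S) ∧
      ∀ D c : ℝ, 1 ≤ D → 1 ≤ c →
        1 + Real.log (max 1 (24 * R * S / (c * D))) ≤ 8 * Real.log (2 * R * S) := by
  have hRS : 1 ≤ R * S := by nlinarith
  have hlog2 : (0.6931471803 : ℝ) < Real.log 2 := Real.log_two_gt_d9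
  have h1 : Real.log 2 ≤ Real.log (2 * R * S) :=
    Real.log_le_log (by norm_num) (by nlinarith)
  have h2 : 1 ≤ 2 * Real.log (2 * R * S) := by linarith
  have h3 : Real.log (2 * R) ≤ Real.log (2 * R * S) :=
    Real.log_le_log (by linarith) (by nlinarith)
  have h4 : 0 ≤ Real.log (R * S) := Real.log_nonneg hRS
  have h5 : Real.log (R * S) ≤ Real.log (2 * R * S) :=
    Real.log_le_log (by linarith) (by nlinarith)
  have h6 : 0 ≤ Real.log S := Real.log_nonneg hS
  have h7 : Real.log S ≤ Real.log (2 * R * S) :=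
    Real.log_le_log (by linarith) (by nlinarith)
  refine ⟨h1, h2, h3, h4, h5, h6, h7, fun D c hD hc => ?_⟩
  have hm : max 1 (24 * R * S / (c * D)) ≤ 32 * (R * S) := by
    refine max_le (by nlinarith) ?_
    rw [div_le_iff₀ (by positivity)]
    have : 0 ≤ R * S := by positivity
    nlinarith [mul_nonneg this (show (0:ℝ) ≤ c * D - 1 by nlinarith)]
  have h8 : Real.log (max 1 (24 * R * S / (c * D))) ≤ Real.log (32 * (R * S)) :=
    Real.log_le_log (lt_of_lt_of_le one_pos (le_max_left _ _)) hm
  have h9 : Real.log (32 * (R * S)) = 5 * Real.log 2 + Real.log (R * S) := by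
    rw [Real.log_mul (by norm_num) (by positivity), show (32 : ℝ) = 2 ^ 5 by norm_num, Real.log_pow]
    push_cast
    ring
  linarith

/-- **The choice `H = (RS/D)^{1/3}`** [FI, §12, before (12.4)]: for `1 ≤ D < RS` and
`H = (RS/D)^{1/3}`: `1 ≤ H`, `RS/H = D^{1/3}(RS)^{2/3}`, `√(D·H·RS) = D^{1/3}(RS)^{2/3}`,
`H² √(RS) ≤ (RS)^{3/2}/D`, `RS/(HD) = H²`, and `0 ≤ log H ≤ log 2RS`.
[cite: FriedlanderIwaniecAnnals1998, §12, (12.4)] -/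
theorem rpow_third_bookkeeping {R S D : ℝ} (hR : 1 ≤ R) (hS : 1 ≤ S) (hD : 1 ≤ D) (hDRS : D < R * S) :
    let H : ℝ := (R * S / D) ^ (1 / 3 : ℝ)
    1 ≤ H ∧ R * S / H = D ^ (1 / 3 : ℝ) * (R * S) ^ (2 / 3 : ℝ) ∧
      Real.sqrt (D * H * (R * S)) = D ^ (1 / 3 : ℝ) * (R * S) ^ (2 / 3 : ℝ) ∧
      H ^ 2 * Real.sqrt (R * S) ≤ (R * S) ^ (3 / 2 : ℝ) / D ∧ R * S / (H * D) = H ^ 2 ∧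
      0 ≤ Real.log H ∧ Real.log H ≤ Real.log (2 * R * S) := by
  intro H
  have hRS0 : 0 < R * S := by positivity
  have hD0 : 0 < D := by linarith
  have hq : 1 < R * S / D := by rw [lt_div_iff₀ hD0]; linarith
  have hq0 : 0 < R * S / D := by linarith
  have hH1 : 1 ≤ H := Real.one_le_rpow hq.le (by norm_num)
  have hH0 : 0 < H := by linarith
  -- `H³ = RS/D`
  have hH3 : H ^ 3 = R * S / D := by
    show ((R * S / D) ^ (1 / 3 : ℝ)) ^ 3 = R * S / D
    rw [← Real.rpow_natCast, ← Real.rpow_mul hq0.le]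
    norm_num
  -- express everything through `u = D^{1/3}`, `v = (RS)^{1/3}`
  set u : ℝ := D ^ (1 / 3 : ℝ) with hu
  set v : ℝ := (R * S) ^ (1 / 3 : ℝ) with hv
  have hu0 : 0 < u := Real.rpow_pos_of_pos hD0 _
  have hv0 : 0 < v := Real.rpow_pos_of_pos hRS0 _
  have hu3 : u ^ 3 = D := by
    rw [hu, ← Real.rpow_natCast, ← Real.rpow_mul hD0.le]; norm_num
  have hv3 : v ^ 3 = R * S := by
    rw [hv, ← Real.rpow_natCast, ← Real.rpow_mul hRS0.le]; norm_num
  have hHuv : H = v / u := by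
    show (R * S / D) ^ (1 / 3 : ℝ) = v / u
    rw [hv, hu, ← Real.div_rpow hRS0.le hD0.le]
  have hv2 : (R * S) ^ (2 / 3 : ℝ) = v ^ 2 := by
    rw [hv, ← Real.rpow_natCast, ← Real.rpow_mul hRS0.le]; norm_num
  have hv32 : (R * S) ^ (3 / 2 : ℝ) = Real.sqrt (R * S) * (R * S) := by
    rw [show (3 / 2 : ℝ) = 1 / 2 + 1 by norm_num, Real.rpow_add hRS0, Real.rpow_one,
      Real.sqrt_eq_rpow]
  have hsRS : Real.sqrt (R * S) ^ 2 = R * S := Real.sq_sqrt hRS0.le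
  have hsRS0 : 0 < Real.sqrt (R * S) := Real.sqrt_pos.mpr hRS0
  refine ⟨hH1, ?_, ?_, ?_, ?_, Real.log_nonneg hH1, ?_⟩
  · rw [hHuv, hv2, ← hv3]
    field_simp
  · rw [hv2, hHuv]
    have e : D * (v / u) * (R * S) = (u * v ^ 2) ^ 2 := by
      rw [← hu3, ← hv3]; field_simp
    rw [e, Real.sqrt_sq (by positivity)]
  · -- `H²√(RS) ≤ (RS)^{3/2}/D ⟺ H² D ≤ RS ⟺ v² u ≤ v³ ⟺ u ≤ v`
    have huv : u ≤ v := by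
      rw [hu, hv]
      exact Real.rpow_le_rpow hD0.le hDRS.le (by norm_num)
    rw [hv32, le_div_iff₀ hD0, hHuv]
    have e1 : (v / u) ^ 2 * Real.sqrt (R * S) * D = Real.sqrt (R * S) * (v ^ 2 * u) := by
      rw [← hu3]
      field_simp
    rw [e1]
    calc Real.sqrt (R * S) * (v ^ 2 * u) ≤ Real.sqrt (R * S) * (v ^ 2 * v) :=
          mul_le_mul_of_nonneg_left (mul_le_mul_of_nonneg_left huv (sq_nonneg v)) hsRS0.le
      _ = Real.sqrt (R * S) * (R * S) := by rw [← hv3]; ring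
  · rw [mul_comm H D, ← div_div, ← hH3]
    field_simp
  · -- `log H = (1/3) log(RS/D) ≤ log RS ≤ log 2RS`
    have h1 : Real.log H = (1 / 3 : ℝ) * Real.log (R * S / D) := by
      show Real.log ((R * S / D) ^ (1 / 3 : ℝ)) = _
      rw [Real.log_rpow hq0]
    have h2 : Real.log (R * S / D) ≤ Real.log (2 * R * S) :=
      Real.log_le_log hq0 (by rw [div_le_iff₀ hD0]; nlinarith)
    have h3 : 0 ≤ Real.log (R * S / D) := Real.log_nonneg hq.le
    rw [h1]
    nlinarith

end Literature.NumberTheory.Sieve.FriedlanderIwaniecPrimes
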